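import Summits.FinalStateConjecture.FinalStateConjecture.Theorems.LaminatedThresholdNotSettledCarrierReduction
import Summits.FinalStateConjecture.FinalStateConjecture.Theorems.LaminatedThresholdCagedCombReduction

/-!
# Crux `LaminatedThreshold` · caged comb carriers with the not-settled / sojourn dictionary — ONE-stub forms

Support file for crux item stmt-FinalStateConjecture-16893 (route LaminatedThreshold, crux A), prover seat 0,
2026-08-17 (session 8). State of the crux: the line lead's caged comb line
(`Theorems/LaminatedThresholdCagedCombReduction.lean`, `CagedComb.laminatedThreshold_of_cagedComb`) reads
  adapted comb lemma → CAGED vacuum comb carrier (eventual contraction `∃ N, ‖S ^ (N+1)‖ < 1` of the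
  complement of the unstable direction; nakedness dictionary: a VISIBLE INCOMPLETE NULL RAY in every MGHD)
  → `stub_nakedNotSettled` (visible incomplete null ray ⇒ not settled-T2) → `LaminatedThreshold`,
and the one-stub forms of the heteroclinic comb line (`Theorems/LaminatedThresholdNotSettledCarrierReduction.lean`,
`laminatedThreshold_of_notSettledCarrier` / `laminatedThreshold_of_sojournCarrier`) remove `stub_nakedNotSettled`
by stating the carrier's nakedness dictionary the way the summit states it (¬ settled-T2, resp. incomplete
sojourn-`𝓘⁺`), but ask for contraction `‖S‖ < 1` in the given norm.

This file merges the two: the passage CAGED ⟶ ADAPTED (period map `T` ⟶ `T^[N+1]`, radius shrunk so that the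
first `N` iterates stay in the carrier's ball, orbit trichotomy of the iterate ⟹ orbit trichotomy of `T`) does not
look at the nakedness dictionary at all, so it is proved ONCE for an arbitrary dictionary
`D F c` (`adaptedCombData_of_cagedCombData`; the argument is the line lead's
`CagedComb.adaptedCombCarrier_of_cagedCombCarrier`, whose iterate lemmas are reused), and likewise the passage
EXPLICIT CAGE ⟶ CAGED (`cagedCombData_of_explicitCageData`, by `CagedComb.exists_norm_pow_lt_one_of_cage`).
Specialising `D` gives the crux BY NAME from ONE hypothesis in four spellings:
* `laminatedThreshold_of_cagedNotSettledCarrier` — caged carrier, dictionary `¬ SettlesT2`;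
* `laminatedThreshold_of_cagedSojournCarrier` — caged carrier, dictionary `¬ HasCompleteNullInfinity` (sojourn form);
* `laminatedThreshold_of_explicitCageNotSettledCarrier`, `laminatedThreshold_of_explicitCageSojournCarrier` — the
  same with the cage data `(P, Vs, θ)` of idea card `equivariant-cage` in place of eventual contraction.
In each the abstract comb lemma is discharged by seat 1's landed `Comb.comb_lemma_adapted` (through the imported
one-stub reductions), so NO causal-geometry stub and NO comb stub remains: the caged line is one physics stub
(the carrier) away from the crux. Mathlib + landed Theorems files only; no definitions, no named facts.
-/

-- every `Summit.FinalStateConjecture.FinalStateConjecture.…` name repeats the summit = sub-problem segment (D-0017 layout)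
set_option linter.dupNamespace false

noncomputable section

open Set Filter Metric Function Topology
open scoped Manifold ContDiff
open Literature.Geometry.Lorentzian
open Summit.FinalStateConjecture.FinalStateConjecture.Theses.LaminatedThreshold
open Summit.FinalStateConjecture.FinalStateConjecture.Theorems.ClusterCompleteness (SettlesT2)

namespace Summit.FinalStateConjecture.FinalStateConjecture.Theorems.LaminatedThreshold

/-- **Caged comb data yield adapted comb data, for an arbitrary nakedness dictionary `D`.** Fix the
`3`-manifold `X`, the base datum `d⋆` and a predicate `D F c` on (local family, parameter). If a Banach space
`E`, a period map `T` of `E × ℝ`, `C¹` on `ball 0 r₀`, `T 0 = 0`, `DT(0) = S ⊕ μ` with EVENTUAL contraction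
`‖S ^ (N+1)‖ < 1` and `1 < μ`, `t`-axis invariant, a reading map `π` (`π d⋆ = 0`, continuous along local
admissible families) and, at every scale, two-sided transverse `C¹` seeds with a tolerance `ε₂` such that the
orbit trichotomy of `π (F c)` under `T` implies `D F c`, are given — then the same holds with GENUINE contraction
`‖S'‖ < 1`: take the period map `T^[N+1]` (linearisation `(S ^ (N+1), μ ^ (N+1))`, `C¹` and axis-preserving on a
shrunken ball), the same `π` and seeds, and a tolerance shrunk so that the first `N` iterates of `T` map it into
the old one, which turns the trichotomy for `T^[N+1]` into the trichotomy for `T`. The argument is the line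
lead's `CagedComb.adaptedCombCarrier_of_cagedCombCarrier` (visible-ray dictionary), made dictionary-free.
[folklore] -/
theorem adaptedCombData_of_cagedCombData {X : Type} [TopologicalSpace X] [ChartedSpace Literature.Geometry.Lorentzian.E3 X] [IsManifold (𝓡 3) ((⊤ : ℕ∞) : WithTop ℕ∞) X]
    (dstar : Literature.Geometry.Lorentzian.InitialDataSet (𝓡 3) X)
    (D : (EuclideanSpace ℝ (Fin 1) → Literature.Geometry.Lorentzian.InitialDataSet (𝓡 3) X) → EuclideanSpace ℝ (Fin 1) → Prop) :
    (∃ (E : Type) (_ : NormedAddCommGroup E) (_ : NormedSpace ℝ E) (_ : CompleteSpace E) (T : E × ℝ → E × ℝ) (S : E →L[ℝ] E) (μ r₀ : ℝ) (π : Literature.Geometry.Lorentzian.InitialDataSet (𝓡 3) X → E × ℝ), T 0 = 0 ∧ 0 < r₀ ∧ ContDiffOn ℝ 1 T (Metric.ball 0 r₀) ∧ HasFDerivAt T ((S.comp (ContinuousLinearMap.fst ℝ E ℝ)).prod (μ • ContinuousLinearMap.snd ℝ E ℝ)) 0 ∧ (∃ N : ℕ, ‖S ^ (N + 1)‖ <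 1) ∧ 1 < μ ∧ (∀ t : ℝ, |t| < r₀ → (T ((0 : E), t)).1 = 0) ∧ π dstar = 0 ∧ (∀ F : EuclideanSpace ℝ (Fin 1) → Literature.Geometry.Lorentzian.InitialDataSet (𝓡 3) X, Literature.Geometry.Lorentzian.InitialDataSet.IsSmoothDataFamily 1 F → F 0 = dstar → (∀ c, F c ∈ Literature.Geometry.Lorentzian.admissibleVacuumData X) → (∃ C : Set X, IsCompact C ∧ ∀ c, ∀ x ∉ C, (F c).h.inner x = dstar.h.inner x ∧ (F c).k x = dstar.k x) → ∃ δ : ℝ, 0 < δ ∧ ContinuousOn (fun c ↦ π (F c)) (Metric.ball 0 δ)) ∧ ∀ r : ℝ, 0 < r → ∃ (σ₁ σ₂ ε₂ : ℝ) (G₁ G₂ : E × ℝ → ℝ), 0 < ε₂ ∧ (0 < σ₁ ∧ σ₁ < r ∧ -r < σ₂ ∧ σ₂ < 0 ∧ (∃ r' : ℝ, 0 < r' ∧ ContDiffOn ℝ 1 G₁ (Metric.ball ((0 : E), σ₁) r') ∧ ContDiffOn ℝ 1 G₂ (Metric.ball ((0 : E), σ₂) r')) ∧ G₁ ((0 :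 E), σ₁) = 0 ∧ fderiv ℝ G₁ ((0 : E), σ₁) ((0 : E), (1 : ℝ)) ≠ 0 ∧ G₂ ((0 : E), σ₂) = 0 ∧ fderiv ℝ G₂ ((0 : E), σ₂) ((0 : E), (1 : ℝ)) ≠ 0) ∧ ∀ F : EuclideanSpace ℝ (Fin 1) → Literature.Geometry.Lorentzian.InitialDataSet (𝓡 3) X, Literature.Geometry.Lorentzian.InitialDataSet.IsSmoothDataFamily 1 F → F 0 = dstar → (∀ c, F c ∈ Literature.Geometry.Lorentzian.admissibleVacuumData X) → (∃ C : Set X, IsCompact C ∧ ∀ c, ∀ x ∉ C, (F c).h.inner x = dstar.h.inner x ∧ (F c).k x = dstar.k x) → ∃ δ : ℝ, 0 < δ ∧ ∀ c ∈ Metric.ball (0 : EuclideanSpace ℝ (Fin 1)) δ, ((∀ n : ℕ, T^[n] (π (F c)) ∈ Metric.ball (0 : E × ℝ) ε₂) ∨ (∃ n : ℕ, T^[n] (π (F c)) ∈ Metric.ball ((0 : E), σ₁) ε₂ ∧ G₁ (T^[n] (π (F c))) = 0) ∨ (∃ n : ℕ, T^[n] (π (F c)) ∈ Metric.ball ((0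 : E), σ₂) ε₂ ∧ G₂ (T^[n] (π (F c))) = 0)) → D F c) → ∃ (E : Type) (_ : NormedAddCommGroup E) (_ : NormedSpace ℝ E) (_ : CompleteSpace E) (T : E × ℝ → E × ℝ) (S : E →L[ℝ] E) (μ r₀ : ℝ) (π : Literature.Geometry.Lorentzian.InitialDataSet (𝓡 3) X → E × ℝ), T 0 = 0 ∧ 0 < r₀ ∧ ContDiffOn ℝ 1 T (Metric.ball 0 r₀) ∧ HasFDerivAt T ((S.comp (ContinuousLinearMap.fst ℝ E ℝ)).prod (μ • ContinuousLinearMap.snd ℝ E ℝ)) 0 ∧ ‖S‖ < 1 ∧ 1 < μ ∧ (∀ t : ℝ, |t| < r₀ → (T ((0 : E), t)).1 = 0) ∧ π dstar = 0 ∧ (∀ F : EuclideanSpace ℝ (Fin 1) → Literature.Geometry.Lorentzian.InitialDataSet (𝓡 3) X, Literature.Geometry.Lorentzian.InitialDataSet.IsSmoothDataFamily 1 F → F 0 = dstar → (∀ c, F c ∈ Literature.Geometry.Lorentzian.admissibleVacuumData X) → (∃ C : Set X, IsCompact C ∧ ∀ c, ∀ x ∉ C, (F c).h.inner x = dstar.h.inner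 x ∧ (F c).k x = dstar.k x) → ∃ δ : ℝ, 0 < δ ∧ ContinuousOn (fun c ↦ π (F c)) (Metric.ball 0 δ)) ∧ ∀ r : ℝ, 0 < r → ∃ (σ₁ σ₂ ε₂ : ℝ) (G₁ G₂ : E × ℝ → ℝ), 0 < ε₂ ∧ (0 < σ₁ ∧ σ₁ < r ∧ -r < σ₂ ∧ σ₂ < 0 ∧ (∃ r' : ℝ, 0 < r' ∧ ContDiffOn ℝ 1 G₁ (Metric.ball ((0 : E), σ₁) r') ∧ ContDiffOn ℝ 1 G₂ (Metric.ball ((0 : E), σ₂) r')) ∧ G₁ ((0 : E), σ₁) = 0 ∧ fderiv ℝ G₁ ((0 : E), σ₁) ((0 : E), (1 : ℝ)) ≠ 0 ∧ G₂ ((0 : E), σ₂) = 0 ∧ fderiv ℝ G₂ ((0 : E), σ₂) ((0 : E), (1 : ℝ)) ≠ 0) ∧ ∀ F : EuclideanSpace ℝ (Fin 1) → Literature.Geometry.Lorentzian.InitialDataSet (𝓡 3) X, Literature.Geometry.Lorentzian.InitialDataSet.IsSmoothDataFamily 1 F → F 0 = dstar → (∀ c, F c ∈ Literature.Geometry.Lorentzian.admissibleVacuumData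 X) → (∃ C : Set X, IsCompact C ∧ ∀ c, ∀ x ∉ C, (F c).h.inner x = dstar.h.inner x ∧ (F c).k x = dstar.k x) → ∃ δ : ℝ, 0 < δ ∧ ∀ c ∈ Metric.ball (0 : EuclideanSpace ℝ (Fin 1)) δ, ((∀ n : ℕ, T^[n] (π (F c)) ∈ Metric.ball (0 : E × ℝ) ε₂) ∨ (∃ n : ℕ, T^[n] (π (F c)) ∈ Metric.ball ((0 : E), σ₁) ε₂ ∧ G₁ (T^[n] (π (F c))) = 0) ∨ (∃ n : ℕ, T^[n] (π (F c)) ∈ Metric.ball ((0 : E), σ₂) ε₂ ∧ G₂ (T^[n] (π (F c))) = 0)) → D F c := by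
  rintro ⟨E, j₁, j₂, j₃, T, S, μ, r₀, π, hT0, hr₀, hT1, hTA, ⟨N, hSN⟩, hμ, haxis, hπ0, hcont, hseed⟩
  -- the number of steps of the new period map
  set M : ℕ := N + 1 with hM
  have hMpos : 0 < M := Nat.succ_pos N
  have hTc : ContinuousOn T (ball 0 r₀) := hT1.continuousOn
  -- a radius on which the first `M` iterates stay in the carrier's ball
  obtain ⟨r₁, hr₁, -, hmaps⟩ := CagedComb.exists_mapsTo_iterate_ball hTc hT0 hr₀ M r₀ hr₀
  refine ⟨E, j₁, j₂, j₃, T^[M], S ^ M, μ ^ M, r₁, π, ?_, hr₁, ?_, ?_, hSN, one_lt_pow₀ hμ hMpos.ne', ?_, hπ0,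
    hcont, ?_⟩
  · -- `T^[M] 0 = 0`
    exact iterate_fixed hT0 M
  · -- `C¹` on the shrunken ball
    have hCk : ∀ j ≤ M, ContDiffOn ℝ 1 T^[j] (ball (0 : E × ℝ) r₁) := by
      intro j
      induction j with
      | zero => intro _; exact contDiffOn_id
      | succ j ih =>
        intro hj
        have hj' : j ≤ M := (Nat.le_succ j).trans hj
        rw [iterate_succ']
        exact hT1.comp (ih hj') (hmaps j hj')
    exact hCk M le_rfl
  · -- linearisation of the iterate
    have h := hTA.iterate hT0 M
    rwa [CagedComb.linearisation_pow] at h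
  · -- the `t`-axis stays invariant under the iterate on the shrunken ball
    have hmapsN : ∀ j ≤ N, MapsTo T^[j] (ball (0 : E × ℝ) r₁) (ball 0 r₀) :=
      fun j hj ↦ hmaps j (hj.trans (Nat.le_succ N))
    intro t ht
    exact CagedComb.iterate_axis haxis hmapsN M le_rfl t ht
  · -- seeds and the dictionary, with the tolerance shrunk
    intro r hr
    obtain ⟨σ₁, σ₂, ε₂, G₁, G₂, hε₂, hseeds, hdict⟩ := hseed r hr
    obtain ⟨ε', hε', hε'ε₂, hsmall⟩ := CagedComb.exists_mapsTo_iterate_ball hTc hT0 hr₀ M ε₂ hε₂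
    refine ⟨σ₁, σ₂, ε', G₁, G₂, hε', hseeds, ?_⟩
    intro F hF h0 hFadm hCpt
    obtain ⟨δ, hδ, hD⟩ := hdict F hF h0 hFadm hCpt
    refine ⟨δ, hδ, fun c hc htri ↦ hD c hc ?_⟩
    -- the trichotomy for `T^[M]` at tolerance `ε'` gives the trichotomy for `T` at tolerance `ε₂`
    set p := π (F c) with hp
    rcases htri with hstay | ⟨n, hn, hG⟩ | ⟨n, hn, hG⟩
    · refine Or.inl fun m ↦ ?_
      have hdecomp : m = m % M + M * (m / M) := (Nat.mod_add_div m M).symm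
      have hlt : m % M < M := Nat.mod_lt m hMpos
      have hq : T^[M * (m / M)] p ∈ ball (0 : E × ℝ) ε' := by
        rw [iterate_mul]; exact hstay (m / M)
      rw [hdecomp, iterate_add_apply]
      exact hsmall (m % M) hlt.le hq
    · refine Or.inr (Or.inl ⟨M * n, ?_, ?_⟩)
      · rw [iterate_mul]; exact ball_subset_ball hε'ε₂ hn
      · rw [iterate_mul]; exact hG
    · refine Or.inr (Or.inr ⟨M * n, ?_, ?_⟩)
      · rw [iterate_mul]; exact ball_subset_ball hε'ε₂ hn
      · rw [iterate_mul]; exact hG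

/-- **Explicitly caged comb data are caged comb data, for an arbitrary dictionary `D`.** The cage data of
idea card `equivariant-cage` on the complement `E` of the unstable direction — an idempotent `P` commuting
with `S`, an `S`-invariant subspace `Vs ⊇ range P` fixed by `P` and `θ`-contracted by `S`, `θ`-contraction of
`ker P`, `0 ≤ θ < 1` — give eventual contraction `∃ N, ‖S ^ (N+1)‖ < 1` by the line lead's cage lemma
`CagedComb.exists_norm_pow_lt_one_of_cage`; every other clause is carried over. [folklore] -/
theorem cagedCombData_of_explicitCageData {X : Type} [TopologicalSpace X] [ChartedSpace Literature.Geometry.Lorentzian.E3 X] [IsManifold (𝓡 3) ((⊤ : ℕ∞) : WithTop ℕ∞) X]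
    (dstar : Literature.Geometry.Lorentzian.InitialDataSet (𝓡 3) X)
    (D : (EuclideanSpace ℝ (Fin 1) → Literature.Geometry.Lorentzian.InitialDataSet (𝓡 3) X) → EuclideanSpace ℝ (Fin 1) → Prop) :
    (∃ (E : Type) (_ : NormedAddCommGroup E) (_ : NormedSpace ℝ E) (_ : CompleteSpace E) (T : E × ℝ → E × ℝ) (S : E →L[ℝ] E) (μ r₀ : ℝ) (π : Literature.Geometry.Lorentzian.InitialDataSet (𝓡 3) X → E × ℝ) (P : E →L[ℝ] E) (Vs : Submodule ℝ E) (θ : ℝ), T 0 = 0 ∧ 0 < r₀ ∧ ContDiffOn ℝ 1 T (Metric.ball 0 r₀) ∧ HasFDerivAt T ((S.comp (ContinuousLinearMap.fst ℝ E ℝ)).prod (μ • ContinuousLinearMap.snd ℝ E ℝ)) 0 ∧ (0 ≤ θ ∧ θ < 1 ∧ (∀ x : E, S (P x) = P (S x)) ∧ (∀ x : E, P x ∈ Vs) ∧ (∀ v ∈ Vs, P v = v) ∧ (∀ v ∈ Vs, S v ∈ Vs) ∧ (∀ v ∈ Vs, ‖S v‖ ≤ θ * ‖v‖) ∧ (∀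 w : E, P w = 0 → ‖S w‖ ≤ θ * ‖w‖)) ∧ 1 < μ ∧ (∀ t : ℝ, |t| < r₀ → (T ((0 : E), t)).1 = 0) ∧ π dstar = 0 ∧ (∀ F : EuclideanSpace ℝ (Fin 1) → Literature.Geometry.Lorentzian.InitialDataSet (𝓡 3) X, Literature.Geometry.Lorentzian.InitialDataSet.IsSmoothDataFamily 1 F → F 0 = dstar → (∀ c, F c ∈ Literature.Geometry.Lorentzian.admissibleVacuumData X) → (∃ C : Set X, IsCompact C ∧ ∀ c, ∀ x ∉ C, (F c).h.inner x = dstar.h.inner x ∧ (F c).k x = dstar.k x) → ∃ δ : ℝ, 0 < δ ∧ ContinuousOn (fun c ↦ π (F c)) (Metric.ball 0 δ)) ∧ ∀ r : ℝ, 0 < r → ∃ (σ₁ σ₂ ε₂ : ℝ) (G₁ G₂ : E × ℝ → ℝ), 0 < ε₂ ∧ (0 < σ₁ ∧ σ₁ < r ∧ -r < σ₂ ∧ σ₂ < 0 ∧ (∃ r' : ℝ, 0 < r' ∧ ContDiffOn ℝ 1 G₁ (Metric.ball ((0 : E), σ₁) r') ∧ ContDiffOn ℝ 1 G₂ (Metric.ball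 ((0 : E), σ₂) r')) ∧ G₁ ((0 : E), σ₁) = 0 ∧ fderiv ℝ G₁ ((0 : E), σ₁) ((0 : E), (1 : ℝ)) ≠ 0 ∧ G₂ ((0 : E), σ₂) = 0 ∧ fderiv ℝ G₂ ((0 : E), σ₂) ((0 : E), (1 : ℝ)) ≠ 0) ∧ ∀ F : EuclideanSpace ℝ (Fin 1) → Literature.Geometry.Lorentzian.InitialDataSet (𝓡 3) X, Literature.Geometry.Lorentzian.InitialDataSet.IsSmoothDataFamily 1 F → F 0 = dstar → (∀ c, F c ∈ Literature.Geometry.Lorentzian.admissibleVacuumData X) → (∃ C : Set X, IsCompact C ∧ ∀ c, ∀ x ∉ C, (F c).h.inner x = dstar.h.inner x ∧ (F c).k x = dstar.k x) → ∃ δ : ℝ, 0 < δ ∧ ∀ c ∈ Metric.ball (0 : EuclideanSpace ℝ (Fin 1)) δ, ((∀ n : ℕ, T^[n] (π (F c)) ∈ Metric.ball (0 : E × ℝ) ε₂) ∨ (∃ n : ℕ, T^[n] (π (F c)) ∈ Metric.ball ((0 : E), σ₁) ε₂ ∧ G₁ (T^[n] (π (F c))) = 0) ∨ (∃ n : ℕ,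 T^[n] (π (F c)) ∈ Metric.ball ((0 : E), σ₂) ε₂ ∧ G₂ (T^[n] (π (F c))) = 0)) → D F c) → ∃ (E : Type) (_ : NormedAddCommGroup E) (_ : NormedSpace ℝ E) (_ : CompleteSpace E) (T : E × ℝ → E × ℝ) (S : E →L[ℝ] E) (μ r₀ : ℝ) (π : Literature.Geometry.Lorentzian.InitialDataSet (𝓡 3) X → E × ℝ), T 0 = 0 ∧ 0 < r₀ ∧ ContDiffOn ℝ 1 T (Metric.ball 0 r₀) ∧ HasFDerivAt T ((S.comp (ContinuousLinearMap.fst ℝ E ℝ)).prod (μ • ContinuousLinearMap.snd ℝ E ℝ)) 0 ∧ (∃ N : ℕ, ‖S ^ (N + 1)‖ < 1) ∧ 1 < μ ∧ (∀ t : ℝ, |t| < r₀ → (T ((0 : E), t)).1 = 0) ∧ π dstar = 0 ∧ (∀ F : EuclideanSpace ℝ (Fin 1) → Literature.Geometry.Lorentzian.InitialDataSet (𝓡 3) X, Literature.Geometry.Lorentzian.InitialDataSet.IsSmoothDataFamily 1 F → F 0 = dstar → (∀ c, F c ∈ Literature.Geometry.Lorentzian.admissibleVacuumData X) → (∃ C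 : Set X, IsCompact C ∧ ∀ c, ∀ x ∉ C, (F c).h.inner x = dstar.h.inner x ∧ (F c).k x = dstar.k x) → ∃ δ : ℝ, 0 < δ ∧ ContinuousOn (fun c ↦ π (F c)) (Metric.ball 0 δ)) ∧ ∀ r : ℝ, 0 < r → ∃ (σ₁ σ₂ ε₂ : ℝ) (G₁ G₂ : E × ℝ → ℝ), 0 < ε₂ ∧ (0 < σ₁ ∧ σ₁ < r ∧ -r < σ₂ ∧ σ₂ < 0 ∧ (∃ r' : ℝ, 0 < r' ∧ ContDiffOn ℝ 1 G₁ (Metric.ball ((0 : E), σ₁) r') ∧ ContDiffOn ℝ 1 G₂ (Metric.ball ((0 : E), σ₂) r')) ∧ G₁ ((0 : E), σ₁) = 0 ∧ fderiv ℝ G₁ ((0 : E), σ₁) ((0 : E), (1 : ℝ)) ≠ 0 ∧ G₂ ((0 : E), σ₂) = 0 ∧ fderiv ℝ G₂ ((0 : E), σ₂) ((0 : E), (1 : ℝ)) ≠ 0) ∧ ∀ F : EuclideanSpace ℝ (Fin 1) → Literature.Geometry.Lorentzian.InitialDataSet (𝓡 3) X, Literature.Geometry.Lorentzian.InitialDataSet.IsSmoothDataFamily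 1 F → F 0 = dstar → (∀ c, F c ∈ Literature.Geometry.Lorentzian.admissibleVacuumData X) → (∃ C : Set X, IsCompact C ∧ ∀ c, ∀ x ∉ C, (F c).h.inner x = dstar.h.inner x ∧ (F c).k x = dstar.k x) → ∃ δ : ℝ, 0 < δ ∧ ∀ c ∈ Metric.ball (0 : EuclideanSpace ℝ (Fin 1)) δ, ((∀ n : ℕ, T^[n] (π (F c)) ∈ Metric.ball (0 : E × ℝ) ε₂) ∨ (∃ n : ℕ, T^[n] (π (F c)) ∈ Metric.ball ((0 : E), σ₁) ε₂ ∧ G₁ (T^[n] (π (F c))) = 0) ∨ (∃ n : ℕ, T^[n] (π (F c)) ∈ Metric.ball ((0 : E), σ₂) ε₂ ∧ G₂ (T^[n] (π (F c))) = 0)) → D F c := by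
  rintro ⟨E, j₁, j₂, j₃, T, S, μ, r₀, π, P, Vs, θ, hT0, hr₀, hT1, hTA, ⟨hθ0, hθ1, hcomm, hPV, hVP, hSV, hSVs, hSW⟩,
    hμ, haxis, hπ0, hcont, hseed⟩
  exact ⟨E, j₁, j₂, j₃, T, S, μ, r₀, π, hT0, hr₀, hT1, hTA,
    CagedComb.exists_norm_pow_lt_one_of_cage S P Vs θ hθ0 hθ1 hcomm hPV hVP hSV hSVs hSW, hμ, haxis, hπ0, hcont,
    hseed⟩

/-- **Crux A from ONE stub: the CAGED vacuum comb carrier with the not-settled dictionary.** As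
`laminatedThreshold_of_notSettledCarrier` (admissible `d⋆`; `C¹` period map `T` with `T 0 = 0`, `DT(0) = S ⊕ μ`,
`1 < μ`, `t`-axis invariant; reading map `π`, `π d⋆ = 0`, continuous along local admissible families; two-sided
transverse `C¹` seeds with tolerance `ε₂` at every scale; orbit trichotomy ⟹ no MGHD of the member is
settled-T2), but with contraction of the complement of the unstable direction only EVENTUAL,
`∃ N, ‖S ^ (N+1)‖ < 1` (spectral radius `< 1` — what a cage delivers). Proof: `adaptedCombData_of_cagedCombData`,
then the landed one-stub reduction (comb lemma discharged there by `Comb.comb_lemma_adapted`).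
[cite: GrebogiEtAl1983] [cite: McdonaldEtAl1985] -/
theorem laminatedThreshold_of_cagedNotSettledCarrier : (∃ (X : Type) (_ : TopologicalSpace X) (_ : ChartedSpace Literature.Geometry.Lorentzian.E3 X) (_ : IsManifold (𝓡 3) ((⊤ : ℕ∞) : WithTop ℕ∞) X) (_ : T2Space X) (_ : SecondCountableTopology X) (_ : ConnectedSpace X) (dstar : Literature.Geometry.Lorentzian.InitialDataSet (𝓡 3) X) (E : Type) (_ : NormedAddCommGroup E) (_ : NormedSpace ℝ E) (_ : CompleteSpace E) (T : E × ℝ → E × ℝ) (S : E →L[ℝ] E) (μ r₀ : ℝ) (π : Literature.Geometry.Lorentzian.InitialDataSet (𝓡 3) X → E × ℝ), dstar ∈ Literature.Geometry.Lorentzian.admissibleVacuumData X ∧ T 0 = 0 ∧ 0 < r₀ ∧ ContDiffOn ℝ 1 T (Metric.ball 0 r₀) ∧ HasFDerivAt T ((S.comp (ContinuousLinearMap.fst ℝ E ℝ)).prod (μ • ContinuousLinearMap.snd ℝ E ℝ)) 0 ∧ (∃ N : ℕ, ‖S ^ (N + 1)‖ < 1) ∧ 1 < μ ∧ (∀ t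 : ℝ, |t| < r₀ → (T ((0 : E), t)).1 = 0) ∧ π dstar = 0 ∧ (∀ F : EuclideanSpace ℝ (Fin 1) → Literature.Geometry.Lorentzian.InitialDataSet (𝓡 3) X, Literature.Geometry.Lorentzian.InitialDataSet.IsSmoothDataFamily 1 F → F 0 = dstar → (∀ c, F c ∈ Literature.Geometry.Lorentzian.admissibleVacuumData X) → (∃ C : Set X, IsCompact C ∧ ∀ c, ∀ x ∉ C, (F c).h.inner x = dstar.h.inner x ∧ (F c).k x = dstar.k x) → ∃ δ : ℝ, 0 < δ ∧ ContinuousOn (fun c ↦ π (F c)) (Metric.ball 0 δ)) ∧ ∀ r : ℝ, 0 < r → ∃ (σ₁ σ₂ ε₂ : ℝ) (G₁ G₂ : E × ℝ → ℝ), 0 < ε₂ ∧ (0 < σ₁ ∧ σ₁ < r ∧ -r < σ₂ ∧ σ₂ < 0 ∧ (∃ r' : ℝ, 0 < r' ∧ ContDiffOn ℝ 1 G₁ (Metric.ball ((0 : E), σ₁) r') ∧ ContDiffOn ℝ 1 G₂ (Metric.ball ((0 : E), σ₂) r')) ∧ G₁ ((0 : E), σ₁) = 0 ∧ fderiv ℝ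 G₁ ((0 : E), σ₁) ((0 : E), (1 : ℝ)) ≠ 0 ∧ G₂ ((0 : E), σ₂) = 0 ∧ fderiv ℝ G₂ ((0 : E), σ₂) ((0 : E), (1 : ℝ)) ≠ 0) ∧ ∀ F : EuclideanSpace ℝ (Fin 1) → Literature.Geometry.Lorentzian.InitialDataSet (𝓡 3) X, Literature.Geometry.Lorentzian.InitialDataSet.IsSmoothDataFamily 1 F → F 0 = dstar → (∀ c, F c ∈ Literature.Geometry.Lorentzian.admissibleVacuumData X) → (∃ C : Set X, IsCompact C ∧ ∀ c, ∀ x ∉ C, (F c).h.inner x = dstar.h.inner x ∧ (F c).k x = dstar.k x) → ∃ δ : ℝ, 0 < δ ∧ ∀ c ∈ Metric.ball (0 : EuclideanSpace ℝ (Fin 1)) δ, ((∀ n : ℕ, T^[n] (π (F c)) ∈ Metric.ball (0 : E × ℝ) ε₂) ∨ (∃ n : ℕ, T^[n] (π (F c)) ∈ Metric.ball ((0 : E), σ₁) ε₂ ∧ G₁ (T^[n] (π (F c))) = 0) ∨ (∃ n : ℕ, T^[n] (π (F c)) ∈ Metric.ball ((0 : E), σ₂) ε₂ ∧ G₂ (T^[n]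 (π (F c))) = 0)) → ∀ 𝒟 : Literature.Geometry.Lorentzian.VacuumCauchyDevelopment (F c), 𝒟.IsMaximal → ¬ Summit.FinalStateConjecture.FinalStateConjecture.Theorems.ClusterCompleteness.SettlesT2 𝒟) → Summit.FinalStateConjecture.FinalStateConjecture.Theses.LaminatedThreshold.LaminatedThreshold := by
  rintro ⟨X, i₁, i₂, i₃, i₄, i₅, i₆, dstar, E, j₁, j₂, j₃, T, S, μ, r₀, π, hadm, hrest⟩
  obtain ⟨E', j₁', j₂', j₃', T', S', μ', r₀', π', h⟩ :=
    adaptedCombData_of_cagedCombData dstar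
      (fun F c ↦ ∀ 𝒟 : Literature.Geometry.Lorentzian.VacuumCauchyDevelopment (F c), 𝒟.IsMaximal → ¬ Summit.FinalStateConjecture.FinalStateConjecture.Theorems.ClusterCompleteness.SettlesT2 𝒟)
      ⟨E, j₁, j₂, j₃, T, S, μ, r₀, π, hrest⟩
  exact laminatedThreshold_of_notSettledCarrier ⟨X, i₁, i₂, i₃, i₄, i₅, i₆, dstar, E', j₁', j₂', j₃', T', S', μ', r₀', π', hadm, h⟩

/-- **Crux A from ONE stub: the CAGED vacuum comb carrier with the sojourn dictionary** — the same carrier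
whose coded members have, in every maximal vacuum development, INCOMPLETE future null infinity in
Christodoulou's sojourn sense (`¬ HasCompleteNullInfinity`), the form in which the physics of a naked threshold
would deliver nakedness; eventual contraction `∃ N, ‖S ^ (N+1)‖ < 1` only. Proof:
`adaptedCombData_of_cagedCombData`, then `laminatedThreshold_of_sojournCarrier`.
[cite: GrebogiEtAl1983] [cite: McdonaldEtAl1985] -/
theorem laminatedThreshold_of_cagedSojournCarrier : (∃ (X : Type) (_ : TopologicalSpace X) (_ : ChartedSpace Literature.Geometry.Lorentzian.E3 X) (_ : IsManifold (𝓡 3) ((⊤ : ℕ∞) : WithTop ℕ∞) X) (_ : T2Space X) (_ : SecondCountableTopology X) (_ : ConnectedSpace X) (dstar : Literature.Geometry.Lorentzian.InitialDataSet (𝓡 3) X) (E : Type) (_ : NormedAddCommGroup E) (_ : NormedSpace ℝ E) (_ : CompleteSpace E) (T : E × ℝ → E × ℝ) (S : E →L[ℝ] E) (μ r₀ : ℝ) (π : Literature.Geometry.Lorentzian.InitialDataSet (𝓡 3) X → E × ℝ), dstar ∈ Literature.Geometry.Lorentzian.admissibleVacuumData X ∧ T 0 = 0 ∧ 0 < r₀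 ∧ ContDiffOn ℝ 1 T (Metric.ball 0 r₀) ∧ HasFDerivAt T ((S.comp (ContinuousLinearMap.fst ℝ E ℝ)).prod (μ • ContinuousLinearMap.snd ℝ E ℝ)) 0 ∧ (∃ N : ℕ, ‖S ^ (N + 1)‖ < 1) ∧ 1 < μ ∧ (∀ t : ℝ, |t| < r₀ → (T ((0 : E), t)).1 = 0) ∧ π dstar = 0 ∧ (∀ F : EuclideanSpace ℝ (Fin 1) → Literature.Geometry.Lorentzian.InitialDataSet (𝓡 3) X, Literature.Geometry.Lorentzian.InitialDataSet.IsSmoothDataFamily 1 F → F 0 = dstar → (∀ c, F c ∈ Literature.Geometry.Lorentzian.admissibleVacuumData X) → (∃ C : Set X, IsCompact C ∧ ∀ c, ∀ x ∉ C, (F c).h.inner x = dstar.h.inner x ∧ (F c).k x = dstar.k x) → ∃ δ : ℝ, 0 < δ ∧ ContinuousOn (fun c ↦ π (F c)) (Metric.ball 0 δ)) ∧ ∀ r : ℝ, 0 < r → ∃ (σ₁ σ₂ ε₂ : ℝ) (G₁ G₂ : E × ℝ → ℝ), 0 < ε₂ ∧ (0 < σ₁ ∧ σ₁ < r ∧ -r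 < σ₂ ∧ σ₂ < 0 ∧ (∃ r' : ℝ, 0 < r' ∧ ContDiffOn ℝ 1 G₁ (Metric.ball ((0 : E), σ₁) r') ∧ ContDiffOn ℝ 1 G₂ (Metric.ball ((0 : E), σ₂) r')) ∧ G₁ ((0 : E), σ₁) = 0 ∧ fderiv ℝ G₁ ((0 : E), σ₁) ((0 : E), (1 : ℝ)) ≠ 0 ∧ G₂ ((0 : E), σ₂) = 0 ∧ fderiv ℝ G₂ ((0 : E), σ₂) ((0 : E), (1 : ℝ)) ≠ 0) ∧ ∀ F : EuclideanSpace ℝ (Fin 1) → Literature.Geometry.Lorentzian.InitialDataSet (𝓡 3) X, Literature.Geometry.Lorentzian.InitialDataSet.IsSmoothDataFamily 1 F → F 0 = dstar → (∀ c, F c ∈ Literature.Geometry.Lorentzian.admissibleVacuumData X) → (∃ C : Set X, IsCompact C ∧ ∀ c, ∀ x ∉ C, (F c).h.inner x = dstar.h.inner x ∧ (F c).k x = dstar.k x) → ∃ δ : ℝ, 0 < δ ∧ ∀ c ∈ Metric.ball (0 : EuclideanSpace ℝ (Fin 1)) δ, ((∀ n : ℕ, T^[n] (π (F c)) ∈ Metric.ball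 (0 : E × ℝ) ε₂) ∨ (∃ n : ℕ, T^[n] (π (F c)) ∈ Metric.ball ((0 : E), σ₁) ε₂ ∧ G₁ (T^[n] (π (F c))) = 0) ∨ (∃ n : ℕ, T^[n] (π (F c)) ∈ Metric.ball ((0 : E), σ₂) ε₂ ∧ G₂ (T^[n] (π (F c))) = 0)) → ∀ 𝒟 : Literature.Geometry.Lorentzian.VacuumCauchyDevelopment (F c), 𝒟.IsMaximal → ¬ Summit.FinalStateConjecture.HasCompleteNullInfinity 𝒟.toCauchyDevelopment) → Summit.FinalStateConjecture.FinalStateConjecture.Theses.LaminatedThreshold.LaminatedThreshold := by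
  rintro ⟨X, i₁, i₂, i₃, i₄, i₅, i₆, dstar, E, j₁, j₂, j₃, T, S, μ, r₀, π, hadm, hrest⟩
  obtain ⟨E', j₁', j₂', j₃', T', S', μ', r₀', π', h⟩ :=
    adaptedCombData_of_cagedCombData dstar
      (fun F c ↦ ∀ 𝒟 : Literature.Geometry.Lorentzian.VacuumCauchyDevelopment (F c), 𝒟.IsMaximal → ¬ Summit.FinalStateConjecture.HasCompleteNullInfinity 𝒟.toCauchyDevelopment)
      ⟨E, j₁, j₂, j₃, T, S, μ, r₀, π, hrest⟩
  exact laminatedThreshold_of_sojournCarrier ⟨X, i₁, i₂, i₃, i₄, i₅, i₆, dstar, E', j₁', j₂', j₃', T', S', μ', r₀', π', hadm, h⟩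

/-- **Crux A from ONE stub: the EXPLICITLY caged vacuum comb carrier with the not-settled dictionary** — cage
data `(P, Vs, θ)` on the complement of the unstable direction (idea card `equivariant-cage`) in place of
eventual contraction. Proof: `cagedCombData_of_explicitCageData`, then
`laminatedThreshold_of_cagedNotSettledCarrier`. [folklore] -/
theorem laminatedThreshold_of_explicitCageNotSettledCarrier : (∃ (X : Type) (_ : TopologicalSpace X) (_ : ChartedSpace Literature.Geometry.Lorentzian.E3 X) (_ : IsManifold (𝓡 3) ((⊤ : ℕ∞) : WithTop ℕ∞) X) (_ : T2Space X) (_ : SecondCountableTopology X) (_ : ConnectedSpace X) (dstar : Literature.Geometry.Lorentzian.InitialDataSet (𝓡 3) X) (E : Type) (_ : NormedAddCommGroup E) (_ : NormedSpace ℝ E) (_ : CompleteSpace E) (T : E × ℝ → E × ℝ) (S : E →L[ℝ] E) (μ r₀ : ℝ) (π : Literature.Geometry.Lorentzian.InitialDataSet (𝓡 3) X → E × ℝ) (P : E →L[ℝ] E) (Vs : Submodule ℝ E) (θ : ℝ), dstar ∈ Literature.Geometry.Lorentzian.admissibleVacuumData X ∧ T 0 = 0 ∧ 0 < r₀ ∧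 ContDiffOn ℝ 1 T (Metric.ball 0 r₀) ∧ HasFDerivAt T ((S.comp (ContinuousLinearMap.fst ℝ E ℝ)).prod (μ • ContinuousLinearMap.snd ℝ E ℝ)) 0 ∧ (0 ≤ θ ∧ θ < 1 ∧ (∀ x : E, S (P x) = P (S x)) ∧ (∀ x : E, P x ∈ Vs) ∧ (∀ v ∈ Vs, P v = v) ∧ (∀ v ∈ Vs, S v ∈ Vs) ∧ (∀ v ∈ Vs, ‖S v‖ ≤ θ * ‖v‖) ∧ (∀ w : E, P w = 0 → ‖S w‖ ≤ θ * ‖w‖)) ∧ 1 < μ ∧ (∀ t : ℝ, |t| < r₀ → (T ((0 : E), t)).1 = 0) ∧ π dstar = 0 ∧ (∀ F : EuclideanSpace ℝ (Fin 1) → Literature.Geometry.Lorentzian.InitialDataSet (𝓡 3) X, Literature.Geometry.Lorentzian.InitialDataSet.IsSmoothDataFamily 1 F → F 0 = dstar → (∀ c, F c ∈ Literature.Geometry.Lorentzian.admissibleVacuumData X) → (∃ C : Set X, IsCompact C ∧ ∀ c, ∀ x ∉ C, (F c).h.inner x = dstar.h.inner x ∧ (F c).k x = dstar.k x) → ∃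 δ : ℝ, 0 < δ ∧ ContinuousOn (fun c ↦ π (F c)) (Metric.ball 0 δ)) ∧ ∀ r : ℝ, 0 < r → ∃ (σ₁ σ₂ ε₂ : ℝ) (G₁ G₂ : E × ℝ → ℝ), 0 < ε₂ ∧ (0 < σ₁ ∧ σ₁ < r ∧ -r < σ₂ ∧ σ₂ < 0 ∧ (∃ r' : ℝ, 0 < r' ∧ ContDiffOn ℝ 1 G₁ (Metric.ball ((0 : E), σ₁) r') ∧ ContDiffOn ℝ 1 G₂ (Metric.ball ((0 : E), σ₂) r')) ∧ G₁ ((0 : E), σ₁) = 0 ∧ fderiv ℝ G₁ ((0 : E), σ₁) ((0 : E), (1 : ℝ)) ≠ 0 ∧ G₂ ((0 : E), σ₂) = 0 ∧ fderiv ℝ G₂ ((0 : E), σ₂) ((0 : E), (1 : ℝ)) ≠ 0) ∧ ∀ F : EuclideanSpace ℝ (Fin 1) → Literature.Geometry.Lorentzian.InitialDataSet (𝓡 3) X, Literature.Geometry.Lorentzian.InitialDataSet.IsSmoothDataFamily 1 F → F 0 = dstar → (∀ c, F c ∈ Literature.Geometry.Lorentzian.admissibleVacuumData X) → (∃ C :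 Set X, IsCompact C ∧ ∀ c, ∀ x ∉ C, (F c).h.inner x = dstar.h.inner x ∧ (F c).k x = dstar.k x) → ∃ δ : ℝ, 0 < δ ∧ ∀ c ∈ Metric.ball (0 : EuclideanSpace ℝ (Fin 1)) δ, ((∀ n : ℕ, T^[n] (π (F c)) ∈ Metric.ball (0 : E × ℝ) ε₂) ∨ (∃ n : ℕ, T^[n] (π (F c)) ∈ Metric.ball ((0 : E), σ₁) ε₂ ∧ G₁ (T^[n] (π (F c))) = 0) ∨ (∃ n : ℕ, T^[n] (π (F c)) ∈ Metric.ball ((0 : E), σ₂) ε₂ ∧ G₂ (T^[n] (π (F c))) = 0)) → ∀ 𝒟 : Literature.Geometry.Lorentzian.VacuumCauchyDevelopment (F c), 𝒟.IsMaximal → ¬ Summit.FinalStateConjecture.FinalStateConjecture.Theorems.ClusterCompleteness.SettlesT2 𝒟) → Summit.FinalStateConjecture.FinalStateConjecture.Theses.LaminatedThreshold.LaminatedThreshold := by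
  rintro ⟨X, i₁, i₂, i₃, i₄, i₅, i₆, dstar, E, j₁, j₂, j₃, T, S, μ, r₀, π, P, Vs, θ, hadm, hrest⟩
  obtain ⟨E', j₁', j₂', j₃', T', S', μ', r₀', π', h⟩ :=
    cagedCombData_of_explicitCageData dstar
      (fun F c ↦ ∀ 𝒟 : Literature.Geometry.Lorentzian.VacuumCauchyDevelopment (F c), 𝒟.IsMaximal → ¬ Summit.FinalStateConjecture.FinalStateConjecture.Theorems.ClusterCompleteness.SettlesT2 𝒟)
      ⟨E, j₁, j₂, j₃, T, S, μ, r₀, π, P, Vs, θ, hrest⟩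
  exact laminatedThreshold_of_cagedNotSettledCarrier ⟨X, i₁, i₂, i₃, i₄, i₅, i₆, dstar, E', j₁', j₂', j₃', T', S', μ', r₀', π', hadm, h⟩

/-- **Crux A from ONE stub: the EXPLICITLY caged vacuum comb carrier with the sojourn dictionary** — cage data
`(P, Vs, θ)` in place of eventual contraction, nakedness as `¬ HasCompleteNullInfinity` of every MGHD of a coded
member. Proof: `cagedCombData_of_explicitCageData`, then `laminatedThreshold_of_cagedSojournCarrier`.
[folklore] -/
theorem laminatedThreshold_of_explicitCageSojournCarrier : (∃ (X : Type) (_ : TopologicalSpace X) (_ : ChartedSpace Literature.Geometry.Lorentzian.E3 X) (_ : IsManifold (𝓡 3) ((⊤ : ℕ∞) : WithTop ℕ∞) X) (_ : T2Space X) (_ : SecondCountableTopology X) (_ : ConnectedSpace X) (dstar : Literature.Geometry.Lorentzian.InitialDataSet (𝓡 3) X) (E : Type) (_ : NormedAddCommGroup E) (_ : NormedSpace ℝ E) (_ : CompleteSpace E) (T : E × ℝ → E × ℝ) (S : E →L[ℝ] E) (μ r₀ : ℝ) (π : Literature.Geometry.Lorentzian.InitialDataSet (𝓡 3) X → E ×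 ℝ) (P : E →L[ℝ] E) (Vs : Submodule ℝ E) (θ : ℝ), dstar ∈ Literature.Geometry.Lorentzian.admissibleVacuumData X ∧ T 0 = 0 ∧ 0 < r₀ ∧ ContDiffOn ℝ 1 T (Metric.ball 0 r₀) ∧ HasFDerivAt T ((S.comp (ContinuousLinearMap.fst ℝ E ℝ)).prod (μ • ContinuousLinearMap.snd ℝ E ℝ)) 0 ∧ (0 ≤ θ ∧ θ < 1 ∧ (∀ x : E, S (P x) = P (S x)) ∧ (∀ x : E, P x ∈ Vs) ∧ (∀ v ∈ Vs, P v = v) ∧ (∀ v ∈ Vs, S v ∈ Vs) ∧ (∀ v ∈ Vs, ‖S v‖ ≤ θ * ‖v‖) ∧ (∀ w : E, P w = 0 → ‖S w‖ ≤ θ * ‖w‖)) ∧ 1 < μ ∧ (∀ t : ℝ, |t| < r₀ → (T ((0 : E), t)).1 = 0) ∧ π dstar = 0 ∧ (∀ F : EuclideanSpace ℝ (Fin 1) → Literature.Geometry.Lorentzian.InitialDataSet (𝓡 3) X, Literature.Geometry.Lorentzian.InitialDataSet.IsSmoothDataFamily 1 F → F 0 = dstar → (∀ c, F c ∈ Literature.Geometry.Lorentzian.admissibleVacuumData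 X) → (∃ C : Set X, IsCompact C ∧ ∀ c, ∀ x ∉ C, (F c).h.inner x = dstar.h.inner x ∧ (F c).k x = dstar.k x) → ∃ δ : ℝ, 0 < δ ∧ ContinuousOn (fun c ↦ π (F c)) (Metric.ball 0 δ)) ∧ ∀ r : ℝ, 0 < r → ∃ (σ₁ σ₂ ε₂ : ℝ) (G₁ G₂ : E × ℝ → ℝ), 0 < ε₂ ∧ (0 < σ₁ ∧ σ₁ < r ∧ -r < σ₂ ∧ σ₂ < 0 ∧ (∃ r' : ℝ, 0 < r' ∧ ContDiffOn ℝ 1 G₁ (Metric.ball ((0 : E), σ₁) r') ∧ ContDiffOn ℝ 1 G₂ (Metric.ball ((0 : E), σ₂) r')) ∧ G₁ ((0 : E), σ₁) = 0 ∧ fderiv ℝ G₁ ((0 : E), σ₁) ((0 : E), (1 : ℝ)) ≠ 0 ∧ G₂ ((0 : E), σ₂) = 0 ∧ fderiv ℝ G₂ ((0 : E), σ₂) ((0 : E), (1 : ℝ)) ≠ 0) ∧ ∀ F : EuclideanSpace ℝ (Fin 1) → Literature.Geometry.Lorentzian.InitialDataSet (𝓡 3) X, Literature.Geometry.Lorentzian.InitialDataSet.IsSmoothDataFamily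 1 F → F 0 = dstar → (∀ c, F c ∈ Literature.Geometry.Lorentzian.admissibleVacuumData X) → (∃ C : Set X, IsCompact C ∧ ∀ c, ∀ x ∉ C, (F c).h.inner x = dstar.h.inner x ∧ (F c).k x = dstar.k x) → ∃ δ : ℝ, 0 < δ ∧ ∀ c ∈ Metric.ball (0 : EuclideanSpace ℝ (Fin 1)) δ, ((∀ n : ℕ, T^[n] (π (F c)) ∈ Metric.ball (0 : E × ℝ) ε₂) ∨ (∃ n : ℕ, T^[n] (π (F c)) ∈ Metric.ball ((0 : E), σ₁) ε₂ ∧ G₁ (T^[n] (π (F c))) = 0) ∨ (∃ n : ℕ, T^[n] (π (F c)) ∈ Metric.ball ((0 : E), σ₂) ε₂ ∧ G₂ (T^[n] (π (F c))) = 0)) → ∀ 𝒟 : Literature.Geometry.Lorentzian.VacuumCauchyDevelopment (F c), 𝒟.IsMaximal → ¬ Summit.FinalStateConjecture.HasCompleteNullInfinity 𝒟.toCauchyDevelopment) → Summit.FinalStateConjecture.FinalStateConjecture.Theses.LaminatedThreshold.LaminatedThreshold := by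
  rintro ⟨X, i₁, i₂, i₃, i₄, i₅, i₆, dstar, E, j₁, j₂, j₃, T, S, μ, r₀, π, P, Vs, θ, hadm, hrest⟩
  obtain ⟨E', j₁', j₂', j₃', T', S', μ', r₀', π', h⟩ :=
    cagedCombData_of_explicitCageData dstar
      (fun F c ↦ ∀ 𝒟 : Literature.Geometry.Lorentzian.VacuumCauchyDevelopment (F c), 𝒟.IsMaximal → ¬ Summit.FinalStateConjecture.HasCompleteNullInfinity 𝒟.toCauchyDevelopment)
      ⟨E, j₁, j₂, j₃, T, S, μ, r₀, π, P, Vs, θ, hrest⟩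
  exact laminatedThreshold_of_cagedSojournCarrier ⟨X, i₁, i₂, i₃, i₄, i₅, i₆, dstar, E', j₁', j₂', j₃', T', S', μ', r₀', π', hadm, h⟩

end Summit.FinalStateConjecture.FinalStateConjecture.Theorems.LaminatedThreshold

end
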